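import Summits.CriticalPhenomena.PercolationContinuityZ3.Theorems.PercNearOneGluingNoHeavyLowerTailSahiResampledMargin
import Mathlib.Tactic.Linarith
import Mathlib.Tactic.Ring
import HarnessLib

/-!
# `NoHeavyLowerTail` (crux stmt-CriticalPhenomena-4575), P2: the resampled margin is nonnegative for a GATED first member
# `f(c,a) = 1[u₀ ≤ c]·φ(a)` — and `E_3 ≥ E_c[f-weighted Cov_b(g_c,h_c)]` for principal members

Support file of the one-cut programme (Sahi's algebraic route, seat `prim-masterthm-p2`, gen 24; memo
`run/shared/lean/prim/prim-masterthm/FROM-prim-masterthm-p2-g24-RESAMPLED-MARGIN.md`; `--supports stmt-CriticalPhenomena-4575`).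
Pure proofs on top of `…SahiResampledMargin` (p365491); no `sorry`, no definitions, no named facts, standard axioms.

SETTING as there: blocks `α, β, γ` (weights `wA, wB, wC`), `f : γ → α → ℝ`, `g : γ → β → ℝ`, `h : γ → α → β → ℝ`; `M = kplusMargin = Cov(f,gh) + Cov_c(G_C, Ȳ − EH·F)`,
`E_3 = M + fibreCov`.

* `kplusMargin_nonneg_of_principal_mul` — **`M ≥ 0` whenever `f(c,a) = 1[u₀ ≤ c]·φ(a)`** with `φ ≥ 0` monotone (`γ` a finite distributive lattice with an FKG weight, `α` a
  finite distributive lattice with an FKG weight, `β` any finite type with a nonnegative weight, `g, h ≥ 0` monotone in `c` and in `a`).  For cubes: `f` depends on the coordinates it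
  SHARES WITH `g` only through a conjunction (a monomial gate), and arbitrarily (monotonically) on its other coordinates; `g, h` unrestricted.  This contains
  `…SahiResampledMargin.kplusMargin_nonneg_of_principal` (`φ ≡ 1`).  PROOF: `Cov(f,gh) ≥ 0` fibrewise (FKG on `α`, then on `γ`); and with `κ(c) = E_{a,b}[φ(a)(h(c,a,b) − EH)]`
  (monotone in `c`) one has `Ȳ − EH·F = 1_U·κ`, `E_c[1_U κ] = Cov(f,h) ≥ 0` (FKG on `α`, then `γ`), and FKG restricted to the principal up-set `U` (`fkg_sum_principal`) gives
  `μ(U)·E_c[G_C 1_U κ] ≥ E_c[G_C 1_U]·E_c[1_U κ] ≥ μ(U)·Ḡ·E_c[1_U κ]`, i.e. `Cov_c(G_C, 1_U κ) ≥ 0`.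
* `sahiE_three_nonneg_of_principal_mul` — hence Sahi's `C_3` for such a triple on any FKG product of blocks (with FKG on `β` too), with the explicit margin
  `fibreCov_le_sahiE_three_of_principal_mul`: **`E_3(f,g,h) ≥ E_c Cov_b(g_c, Y_c) ≥ 0`**.
HONEST LABEL: a positive stratum for the resampled margin (which is NOT nonnegative in general, `…SahiResampledMargin.kplusMargin_example_neg`); Kahn's Conjecture 5 /
Sahi's `C_3` remain OPEN. [this work]
-/

noncomputable section

open scoped Classical

namespace Summit.CriticalPhenomena.PercolationContinuityZ3.Theorems

namespace SahiResampledMargin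

open Finset
open Literature.Combinatorics.Sahi2008
open SahiTriangleSupermodular (fkg_sum)
open SahiTriangleClassT (swap_bc pull)
open SahiSharedTwoPoint (Y FC HH GG GC Ybar Hbar EH EF Gbar)

variable {α β γ : Type} [Fintype α] [Fintype β] [Fintype γ]
  {wA : α → ℝ} {wB : β → ℝ} {wC : γ → ℝ} {f : γ → α → ℝ} {g : γ → β → ℝ} {h : γ → α → β → ℝ}

omit [Fintype γ] in
/-- Fubini inside a fibre: `K(c) = E_b[g·Y] = E_a[f(c,a)·Z(c,a)]` with `Z(c,a) = E_b[g(c,b)h(c,a,b)]`. [this work] -/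
theorem KK_eq_sum_a (c : γ) :
    KK wA wB f g h c = ∑ a, wA a * (f c a * ∑ b, wB b * (g c b * h c a b)) := by
  unfold KK Y
  simp only [mul_sum]
  rw [sum_comm]
  exact sum_congr rfl fun a _ => sum_congr rfl fun b _ => by ring

omit [Fintype γ] in
/-- `Σ_a wA Z(c,a) = K'(c) = E_b[g·H]`. [this work] -/
theorem sum_Z_eq_KH (c : γ) :
    (∑ a, wA a * ∑ b, wB b * (g c b * h c a b)) = KH wA wB g h c := by
  unfold KH HH
  simp only [mul_sum]
  rw [sum_comm]
  exact sum_congr rfl fun b _ => sum_congr rfl fun a _ => by ring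

/-- **THEOREM (resampled margin with a GATED first member).**  If `f(c,a) = 1[u₀ ≤ c]·φ(a)` with `φ ≥ 0` monotone, `γ, α` finite distributive lattices with FKG weights,
`β` any block with a nonnegative weight, and `g(c,b), h(c,a,b) ≥ 0` monotone in `c` and in `a`, then `kplusMargin ≥ 0`. [this work] -/
theorem kplusMargin_nonneg_of_principal_mul [DistribLattice α] [DistribLattice γ] (hA : IsFKGMeasure wA) (hC : IsFKGMeasure wC)
    (hB0 : ∀ b, 0 ≤ wB b) (u₀ : γ) (φ : α → ℝ) (hφ0 : ∀ a, 0 ≤ φ a) (hφm : Monotone φ) (hf : ∀ c a, f c a = pind u₀ c * φ a)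
    (hg0 : ∀ c b, 0 ≤ g c b) (hgc : ∀ b, Monotone (fun c => g c b))
    (hh0 : ∀ c a b, 0 ≤ h c a b) (hhc : ∀ a b, Monotone (fun c => h c a b)) (hha : ∀ c b, Monotone (fun a => h c a b)) :
    0 ≤ kplusMargin wA wB wC f g h := by
  obtain ⟨hp0, hp1, hpm, hpp⟩ := pind_spec (γ := γ) u₀
  have hA0 := hA.nonneg; have hC0 := hC.nonneg; have hA1 := hA.sum_eq_one
  -- basic nonnegativity / monotonicity facts
  have hf0 : ∀ c a, 0 ≤ f c a := fun c a => by rw [hf]; exact mul_nonneg (hp0 c) (hφ0 a)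
  have hfa : ∀ c, Monotone (f c) := fun c a a' haa => by rw [hf, hf]; exact mul_le_mul_of_nonneg_left (hφm haa) (hp0 c)
  have hfc : ∀ a, Monotone (fun c => f c a) := fun a c c' hcc => by
    show f c a ≤ f c' a; rw [hf, hf]; exact mul_le_mul_of_nonneg_right (hpm hcc) (hφ0 a)
  have hHH0 : ∀ c b, 0 ≤ HH wA h c b := fun c b => sum_nonneg fun a _ => mul_nonneg (hA0 a) (hh0 c a b)
  have hHHc : ∀ b, Monotone (fun c => HH wA h c b) := fun b c c' hcc =>
    sum_le_sum fun a _ => mul_le_mul_of_nonneg_left (hhc a b hcc) (hA0 a)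
  have hGC0 : ∀ c, 0 ≤ GC wB g c := fun c => sum_nonneg fun b _ => mul_nonneg (hB0 b) (hg0 c b)
  have hGCm : Monotone (GC wB g) := fun c c' hcc => sum_le_sum fun b _ => mul_le_mul_of_nonneg_left (hgc b hcc) (hB0 b)
  have hK0 : ∀ c, 0 ≤ KH wA wB g h c := fun c => sum_nonneg fun b _ => mul_nonneg (hB0 b) (mul_nonneg (hg0 c b) (hHH0 c b))
  have hKm : Monotone (KH wA wB g h) := fun c c' hcc => sum_le_sum fun b _ =>
    mul_le_mul_of_nonneg_left (mul_le_mul (hgc b hcc) (hHHc b hcc) (hHH0 c b) (hg0 c' b)) (hB0 b)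
  have hFC0 : ∀ c, 0 ≤ FC wA f c := fun c => sum_nonneg fun a _ => mul_nonneg (hA0 a) (hf0 c a)
  have hFCm : Monotone (FC wA f) := fun c c' hcc => sum_le_sum fun a _ => mul_le_mul_of_nonneg_left (hfc a hcc) (hA0 a)
  -- Z(c,a) = E_b[g h] is nonneg and monotone in a
  set Z : γ → α → ℝ := fun c a => ∑ b, wB b * (g c b * h c a b) with hZ
  have hZ0 : ∀ c a, 0 ≤ Z c a := fun c a => sum_nonneg fun b _ => mul_nonneg (hB0 b) (mul_nonneg (hg0 c b) (hh0 c a b))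
  have hZa : ∀ c, Monotone (Z c) := fun c a a' haa => sum_le_sum fun b _ =>
    mul_le_mul_of_nonneg_left (mul_le_mul_of_nonneg_left (hha c b haa) (hg0 c b)) (hB0 b)
  ------------------------------------------------------------------
  -- TERM 1: Cov(f, gh) = Σ_c wC KK − EF · Σ_c wC KH ≥ 0
  ------------------------------------------------------------------
  have hKK_ge : ∀ c, FC wA f c * KH wA wB g h c ≤ KK wA wB f g h c := by
    intro c
    rw [KK_eq_sum_a, ← sum_Z_eq_KH]
    exact fkg_sum hA (hf0 c) (hZ0 c) (hfa c) (hZa c)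
  have hT1 : 0 ≤ (∑ c, wC c * KK wA wB f g h c) - EF wA wC f * ∑ c, wC c * ∑ b, wB b * (g c b * HH wA h c b) := by
    have h1 : (∑ c, wC c * (FC wA f c * KH wA wB g h c)) ≤ ∑ c, wC c * KK wA wB f g h c :=
      sum_le_sum fun c _ => mul_le_mul_of_nonneg_left (hKK_ge c) (hC0 c)
    have h2 := fkg_sum hC hFC0 hK0 hFCm hKm
    have e : (∑ c, wC c * ∑ b, wB b * (g c b * HH wA h c b)) = ∑ c, wC c * KH wA wB g h c := rfl
    rw [e]; unfold EF; linarith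
  ------------------------------------------------------------------
  -- TERM 2: Cov_c(G_C, Ȳ − EH·F) ≥ 0
  ------------------------------------------------------------------
  -- κ(c) = E_b E_a[φ h] − EH·φ̄  and  Ȳ = 1_U · (κ + EH φ̄),  F = 1_U · φ̄
  set φbar : ℝ := ∑ a, wA a * φ a with hφbar
  set Yφ : γ → ℝ := fun c => ∑ b, wB b * ∑ a, wA a * (φ a * h c a b) with hYφ
  have hF : ∀ c, FC wA f c = pind u₀ c * φbar := by
    intro c; unfold FC; rw [hφbar, mul_sum]; exact sum_congr rfl fun a _ => by rw [hf]; ring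
  have hYb : ∀ c, Ybar wA wB f h c = pind u₀ c * Yφ c := by
    intro c; unfold Ybar Y; rw [hYφ]; simp only [mul_sum]
    exact sum_congr rfl fun b _ => sum_congr rfl fun a _ => by rw [hf]; ring
  have hYφm : Monotone Yφ := fun c c' hcc => sum_le_sum fun b _ => mul_le_mul_of_nonneg_left
    (sum_le_sum fun a _ => mul_le_mul_of_nonneg_left (mul_le_mul_of_nonneg_left (hhc a b hcc) (hφ0 a)) (hA0 a)) (hB0 b)
  -- Hbar monotone nonneg (for FKG on γ)
  have hHb0 : ∀ c, 0 ≤ Hbar wA wB h c := fun c => sum_nonneg fun b _ => mul_nonneg (hB0 b) (hHH0 c b)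
  have hHbm : Monotone (Hbar wA wB h) := fun c c' hcc => sum_le_sum fun b _ => mul_le_mul_of_nonneg_left (hHHc b hcc) (hB0 b)
  -- X' := Σ_c wC Ȳ − EH·EF = Cov(f,h) ≥ 0 : FKG on α (fibrewise) then FKG on γ
  have hX' : 0 ≤ (∑ c, wC c * Ybar wA wB f h c) - EH wA wB wC h * EF wA wC f := by
    have h1 : (∑ c, wC c * (FC wA f c * Hbar wA wB h c)) ≤ ∑ c, wC c * Ybar wA wB f h c :=
      sum_le_sum fun c _ => mul_le_mul_of_nonneg_left
        (SahiSharedTwoPoint.FHbar_le_Ybar hA hB0 hf0 hh0 hfa hha c) (hC0 c)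
    have h2 := fkg_sum hC hFC0 hHb0 hFCm hHbm
    unfold EF EH at *
    linarith
  -- κ and the two rewritings
  set κ : γ → ℝ := fun c => Yφ c - EH wA wB wC h * φbar with hκ
  have hκm : Monotone κ := fun c c' hcc => sub_le_sub_right (hYφm hcc) _
  have hEF : EF wA wC f = ∑ c, wC c * (pind u₀ c * φbar) := by
    unfold EF; exact sum_congr rfl fun c _ => by rw [hF]
  have eX : (∑ c, wC c * Ybar wA wB f h c) - EH wA wB wC h * EF wA wC f = ∑ c, wC c * pind u₀ c * κ c := by
    rw [hEF, mul_sum, ← sum_sub_distrib]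
    exact sum_congr rfl fun c _ => by rw [hYb, hκ]; ring
  have eS1 : (∑ c, wC c * (GC wB g c * Ybar wA wB f h c)) - EH wA wB wC h * ∑ c, wC c * (FC wA f c * GC wB g c) =
      ∑ c, wC c * pind u₀ c * (GC wB g c * κ c) := by
    rw [mul_sum, ← sum_sub_distrib]
    exact sum_congr rfl fun c _ => by rw [hYb, hF, hκ]; ring
  have hX : 0 ≤ ∑ c, wC c * pind u₀ c * κ c := by rw [← eX]; exact hX'
  -- FKG restricted to U, and E_c[1_U G_C] ≥ μ(U)·Ḡ
  have key := fkg_sum_principal hC u₀ hGCm hκm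
  have hm0 : 0 ≤ ∑ c, wC c * pind u₀ c := sum_nonneg fun c _ => mul_nonneg (hC0 c) (hp0 c)
  have hYv : (∑ c, wC c * pind u₀ c) * Gbar wB wC g ≤ ∑ c, wC c * pind u₀ c * GC wB g c := by
    have h1 := fkg_sum hC hp0 hGC0 hpm hGCm
    rw [← Gbar_eq_sum_GC] at h1
    refine h1.trans_eq (sum_congr rfl fun c _ => by ring)
  have hT2 : 0 ≤ (∑ c, wC c * (GC wB g c * Ybar wA wB f h c)) - EH wA wB wC h * ∑ c, wC c * (FC wA f c * GC wB g c) -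
      Gbar wB wC g * ((∑ c, wC c * Ybar wA wB f h c) - EH wA wB wC h * EF wA wC f) := by
    rw [eS1, eX]
    rcases hm0.eq_or_lt with hmz | hmpos
    · have hz : ∀ c, wC c * pind u₀ c = 0 := fun c =>
        (sum_eq_zero_iff_of_nonneg (fun c _ => mul_nonneg (hC0 c) (hp0 c))).mp hmz.symm c (mem_univ c)
      simp only [hz, zero_mul, sum_const_zero, mul_zero, sub_zero, le_refl]
    · -- m·S1 ≥ (Σ1_U G_C)(Σ 1_U κ) ≥ m·Ḡ·X
      have hGb0 : 0 ≤ Gbar wB wC g := by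
        rw [Gbar_eq_sum_GC]; exact sum_nonneg fun c _ => mul_nonneg (hC0 c) (hGC0 c)
      have h3 : (∑ c, wC c * pind u₀ c) * Gbar wB wC g * (∑ c, wC c * pind u₀ c * κ c) ≤
          (∑ c, wC c * pind u₀ c) * ∑ c, wC c * pind u₀ c * (GC wB g c * κ c) :=
        (mul_le_mul_of_nonneg_right hYv hX).trans key
      have h4 : Gbar wB wC g * (∑ c, wC c * pind u₀ c * κ c) ≤ ∑ c, wC c * pind u₀ c * (GC wB g c * κ c) := by
        have := h3
        rw [mul_assoc] at this
        exact le_of_mul_le_mul_left this hmpos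
      linarith
  -- assemble
  unfold kplusMargin
  exact add_nonneg hT1 hT2

/-- **COROLLARY (Sahi's `C_3` with a gated first member, with margin).**  Under the hypotheses of `kplusMargin_nonneg_of_principal_mul` plus FKG on `β` and monotonicity
of `g, h` in `b`: `0 ≤ fibreCov ≤ E_3(f,g,h)`. [this work] -/
theorem fibreCov_le_sahiE_three_of_principal_mul [DistribLattice α] [DistribLattice β] [DistribLattice γ]
    (hA : IsFKGMeasure wA) (hB : IsFKGMeasure wB) (hC : IsFKGMeasure wC)
    (u₀ : γ) (φ : α → ℝ) (hφ0 : ∀ a, 0 ≤ φ a) (hφm : Monotone φ) (hf : ∀ c a, f c a = pind u₀ c * φ a)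
    (hg0 : ∀ c b, 0 ≤ g c b) (hgc : ∀ b, Monotone (fun c => g c b))
    (hh0 : ∀ c a b, 0 ≤ h c a b) (hhc : ∀ a b, Monotone (fun c => h c a b))
    (hha : ∀ c b, Monotone (fun a => h c a b)) :
    fibreCov wA wB wC f g h ≤
      sahiE (fun q : α × β × γ => wA q.1 * wB q.2.1 * wC q.2.2) 3
        ![fun q => f q.2.2 q.1, fun q => g q.2.2 q.2.1, fun q => h q.2.2 q.1 q.2.1] := by
  rw [sahiE_three_eq_kplusMargin_add_fibreCov hA.sum_eq_one hB.sum_eq_one]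
  exact le_add_of_nonneg_left
    (kplusMargin_nonneg_of_principal_mul hA hC hB.nonneg u₀ φ hφ0 hφm hf hg0 hgc hh0 hhc hha)

/-- **COROLLARY.**  `E_3(f,g,h) ≥ 0` for a gated first member `f(c,a) = 1[u₀ ≤ c]·φ(a)` on any FKG product of blocks. [this work] -/
theorem sahiE_three_nonneg_of_principal_mul [DistribLattice α] [DistribLattice β] [DistribLattice γ]
    (hA : IsFKGMeasure wA) (hB : IsFKGMeasure wB) (hC : IsFKGMeasure wC)
    (u₀ : γ) (φ : α → ℝ) (hφ0 : ∀ a, 0 ≤ φ a) (hφm : Monotone φ) (hf : ∀ c a, f c a = pind u₀ c * φ a)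
    (hg0 : ∀ c b, 0 ≤ g c b) (hgb : ∀ c, Monotone (g c)) (hgc : ∀ b, Monotone (fun c => g c b))
    (hh0 : ∀ c a b, 0 ≤ h c a b) (hhb : ∀ c a, Monotone (h c a)) (hhc : ∀ a b, Monotone (fun c => h c a b))
    (hha : ∀ c b, Monotone (fun a => h c a b)) :
    0 ≤ sahiE (fun q : α × β × γ => wA q.1 * wB q.2.1 * wC q.2.2) 3
        ![fun q => f q.2.2 q.1, fun q => g q.2.2 q.2.1, fun q => h q.2.2 q.1 q.2.1] :=
  (fibreCov_nonneg hA hB hC.nonneg (fun c a => by rw [hf]; exact mul_nonneg ((pind_spec u₀).1 c) (hφ0 a)) hg0 hgb hh0 hhb).trans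
    (fibreCov_le_sahiE_three_of_principal_mul hA hB hC u₀ φ hφ0 hφm hf hg0 hgc hh0 hhc hha)


/-! ### Cubes -/

/-- **COROLLARY (three cubes with product weights).**  For finite cubes `2^A, 2^B, 2^C` with Bernoulli product weights and `f(c,a) = 1[S₀ ⊆ c]·φ(a)` (a monomial gate on the
`C`-coordinates times a monotone function of the `A`-coordinates), `g(c,b), h(c,a,b) ≥ 0` coordinatewise monotone: the resampled margin is nonnegative and
`0 ≤ E_c Cov_b(g_c,Y_c) ≤ E_3(f,g,h)`. [this work] -/
theorem fibreCov_le_sahiE_three_cubes_of_gated {A B C : Type} [Fintype A] [Fintype B] [Fintype C]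
    (pA : A → unitInterval) (pB : B → unitInterval) (pC : C → unitInterval)
    (f : Set C → Set A → ℝ) (g : Set C → Set B → ℝ) (h : Set C → Set A → Set B → ℝ)
    (S₀ : Set C) (φ : Set A → ℝ) (hφ0 : ∀ a, 0 ≤ φ a) (hφm : Monotone φ) (hf : ∀ c a, f c a = pind S₀ c * φ a)
    (hg0 : ∀ c b, 0 ≤ g c b) (hgb : ∀ c, Monotone (g c)) (hgc : ∀ b, Monotone (fun c => g c b))
    (hh0 : ∀ c a b, 0 ≤ h c a b) (hhb : ∀ c a, Monotone (h c a)) (hhc : ∀ a b, Monotone (fun c => h c a b))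
    (hha : ∀ c b, Monotone (fun a => h c a b)) :
    0 ≤ fibreCov (bernoulliWeight pA) (bernoulliWeight pB) (bernoulliWeight pC) f g h ∧
    fibreCov (bernoulliWeight pA) (bernoulliWeight pB) (bernoulliWeight pC) f g h ≤
      sahiE (fun q : Set A × Set B × Set C =>
        bernoulliWeight pA q.1 * bernoulliWeight pB q.2.1 * bernoulliWeight pC q.2.2) 3
        ![fun q => f q.2.2 q.1, fun q => g q.2.2 q.2.1, fun q => h q.2.2 q.1 q.2.1] :=
  ⟨fibreCov_nonneg (isFKGMeasure_bernoulliWeight pA) (isFKGMeasure_bernoulliWeight pB) (isFKGMeasure_bernoulliWeight pC).nonneg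
      (fun c a => by rw [hf]; exact mul_nonneg ((pind_spec S₀).1 c) (hφ0 a)) hg0 hgb hh0 hhb,
    fibreCov_le_sahiE_three_of_principal_mul (isFKGMeasure_bernoulliWeight pA) (isFKGMeasure_bernoulliWeight pB)
      (isFKGMeasure_bernoulliWeight pC) S₀ φ hφ0 hφm hf hg0 hgc hh0 hhc hha⟩

end SahiResampledMargin

end Summit.CriticalPhenomena.PercolationContinuityZ3.Theorems
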